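import Summits.ResolutionOfSingularities.ResolutionOfSingularities.Theorems.UniversalCellsCampaignW82DiagonalCriterionScheme
import Summits.ResolutionOfSingularities.ResolutionOfSingularities.Theorems.UniversalCellsCampaignW82ExponentZeroProofs
import Literature.AlgebraicGeometry.Resolution.RegularCentreBlowupSeqExtension
import HarnessLib

/-!
# [OURS · L1 W8.2] The diagonal criterion at work: the SELF-PRODUCT of Kollár's REGULAR curve `y^q = x^p − t`
# over `𝔽_p(t)` is a NON-REGULAR surface

Cell `res-hironaka` (run/shared/lean/pub/res-hironaka/), LADDER-RESOLUTION rung L (RESCUE), slot W8.2; host route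
`UniversalCells`, host item `PrimeFieldToPerfect` (stmt-ResolutionOfSingularities-15233), door 1. Proofs file
(Theses-free), written by res-L1-s82-pv-1 (gen 6). A kernel-checked instance of the non-trivial direction of (E5)
(`…DiagonalCriterion(Scheme)`: smooth ⟺ self-product regular): for `p ∤ q` the affine Kollár curve
`C = Spec A`, `A = 𝔽_p(t)[X, Y]/(Y^q − X^p + t)` (barrier file `RegularNotGeometricallyRegular.lean`, `kollarRing p q`)
is a REGULAR scheme (`KollarCurve.isRegularRing_kollarRing`, gen 3) with NO smooth proper birational model
(`KollarCurve.not_hasSmoothProperBirationalModel`), in particular `C ⟶ Spec 𝔽_p(t)` is not smooth; so by (E5):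

* `KollarCurve.not_smooth_f₀` — `C ⟶ Spec 𝔽_p(t)` is not smooth (a smooth `C` would be its own smooth model);
* **`KollarCurve.not_isRegularRing_tensor_self`** — `A ⊗_{𝔽_p(t)} A` is NOT a regular ring although `A` is;
* **`KollarCurve.not_isRegular_pullback_self`** — the surface `C ×_{𝔽_p(t)} C` is not a regular scheme;
  `KollarCurve.isRegular_and_not_isRegular_pullback_self` — the juxtaposition.

So REGULARITY IS NOT INHERITED BY SELF-PRODUCTS over an imperfect field, and the diagonal criterion detects the
barrier `RegularNotGeometricallyRegular` by squaring, with no extension of the ground field.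

HONEST FRAMING. OURS theorems (classical example, Kollár 2007, 1.19); NOT statements of [Hironaka2017]; nothing
attributed to its author. AI work, weaker than expert review; no claim beyond the kernel. No `sorry`, no new axioms.

## References (locators only)
* J. Kollár, *Lectures on Resolution of Singularities* (2007), 1.19. [Kollar2007]
-/

noncomputable section

set_option linter.dupNamespace false -- mandated namespace of this single-conjunct summit

open CategoryTheory CategoryTheory.Limits AlgebraicGeometry TopologicalSpace TensorProduct
open Literature.AlgebraicGeometry.Resolution Literature.Barriers.ResolutionOfSingularities

namespace Summit.ResolutionOfSingularities.ResolutionOfSingularities.Theorems.CampaignW82.KollarCurve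

variable (p : ℕ) [hp : Fact p.Prime] (q : ℕ) [hq : Fact (1 < q)]

/-- **Kollár's regular curve is not smooth over `𝔽_p(t)`** (`p ∤ q`): otherwise it would be its own smooth proper
birational model (`π = 𝟙`), contradicting `KollarCurve.not_hasSmoothProperBirationalModel`.
[cite: Kollar2007, 1.19 (Curves over nonperfect fields)] -/
theorem not_smooth_f₀ (hpq : ¬ p ∣ q) :
    ¬ Smooth (Spec.map (CommRingCat.ofHom (algebraMap (baseField p) (kollarRing p q)))) := by
  intro h
  refine not_hasSmoothProperBirationalModel p q hpq ⟨_, 𝟙 _, inferInstance, isBirational_id _, ?_⟩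
  rw [Category.id_comp]
  exact h

/-- **The self-product of Kollár's regular curve is not regular, as a ring**: `A ⊗_{𝔽_p(t)} A` is NOT a regular
ring for `A = 𝔽_p(t)[X, Y]/(Y^q − X^p + t)`, `p ∤ q` — by the affine diagonal criterion
`smooth_iff_isRegularRing_tensor_self`, regularity of `A ⊗ A` would make `A` smooth over `𝔽_p(t)`. [folklore] -/
theorem not_isRegularRing_tensor_self (hpq : ¬ p ∣ q) :
    ¬ IsRegularRing (kollarRing p q ⊗[baseField p] kollarRing p q) := by
  intro h
  have hsm : Algebra.Smooth (baseField p) (kollarRing p q) :=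
    (smooth_iff_isRegularRing_tensor_self (baseField p) (kollarRing p q)).mpr h
  apply not_smooth_f₀ p q hpq
  rw [HasRingHomProperty.Spec_iff (P := @Smooth)]
  exact RingHom.smooth_algebraMap.mpr hsm

/-- **The surface `C ×_{𝔽_p(t)} C` is not a regular scheme** (`C` Kollár's regular curve, `p ∤ q`): by the scheme
form of the diagonal criterion `smooth_iff_isRegular_pullback_self`. [folklore] -/
theorem not_isRegular_pullback_self (hpq : ¬ p ∣ q) :
    ¬ Scheme.IsRegular
      (pullback (Spec.map (CommRingCat.ofHom (algebraMap (baseField p) (kollarRing p q))))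
        (Spec.map (CommRingCat.ofHom (algebraMap (baseField p) (kollarRing p q))))) := by
  intro h
  haveI := locallyOfFiniteType_f₀ p q
  exact not_smooth_f₀ p q hpq (smooth_of_isRegular_pullback_self _ h)

/-- **Juxtaposition**: Kollár's curve `C` is a REGULAR scheme whose self-product `C ×_{𝔽_p(t)} C` is NOT regular
(`p ∤ q`) — regularity is not inherited by self-products over an imperfect field, and the diagonal criterion
detects non-smoothness without extending the ground field. [folklore] -/
theorem isRegular_and_not_isRegular_pullback_self (hpq : ¬ p ∣ q) :
    Scheme.IsRegular (Spec (.of (kollarRing p q))) ∧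
      ¬ Scheme.IsRegular
        (pullback (Spec.map (CommRingCat.ofHom (algebraMap (baseField p) (kollarRing p q))))
          (Spec.map (CommRingCat.ofHom (algebraMap (baseField p) (kollarRing p q))))) :=
  ⟨isRegular p q hpq, not_isRegular_pullback_self p q hpq⟩

end Summit.ResolutionOfSingularities.ResolutionOfSingularities.Theorems.CampaignW82.KollarCurve

end
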